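import Summits.AnomalousDissipation.AnomalousDissipation.Theses.NeutralTaylorWaves
import Summits.AnomalousDissipation.AnomalousDissipation.Theorems.NonresonantSelection.Negative.SecondSymmetry

/-!
# Negative lemmas for crux `NeutralTaylorWaves.NonresonantSelection` (stmt-AnomalousDissipation-16294):
# border-corrected translation modes bound the bordered constant from below

General form of the translation-mode test behind `bordered_secondSymmetry_rigidity` (cdisprove cycle 1,
2026-08-17). For a smooth divergence-free base `w`, smooth `q`, drift `c`, viscosity `ν`, write
`S := (w·∇)w − νΔw + ∇q − c∂₃w` for the steady map (the crux's residual is `R = S − f`). NO steadiness and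
NO symmetry is assumed:

* `bordered_translationMode_le` — if the BORDERED a-priori clause of the crux's consequent holds at `(w,c)`
  with constant `M`, then for every direction `i`, with `t = ⟨∂ᵢw,∂₃w⟩/‖∂₃w‖₂²`,
  `∫‖∂ᵢw − t∂₃w‖² ≤ M² ∫‖∂ᵢS − t∂₃S‖²`.
  (Test triple `(∂ᵢw − t∂₃w, ∂ᵢq − t∂₃q, 0)`: by the translation identity the linearisation maps it to
  `∂ᵢS − t∂₃S`, and `t` kills the phase border; `‖∂₃w‖₂ > 0` by the border test.)

Reading for the crux (`M = C₀ν^{-K₀}`, `S = f + R`): for an `x₃`-invariant force and a residual that is small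
in `Ḣ¹`, `‖∂ᵢw − t∂₃w‖₂ ≤ C₀ν^{-K₀}(‖∂ᵢf‖₂ + o(1))` for BOTH horizontal directions — the Taylor-scale part of
the witness's gradient must be parallel to `∂₃w` up to `O(ν^{-K₀})`; on the intended monophase family
(`∂ᵢw ≈ ε⁻¹∂ᵢS ∂_θV` with `∂ᵢS = G′(ψ)∂ᵢψ` of variable sign on the band) the left side is `≍ ν^{-1/2}`, so the
natural strengthening `K₀ = 0` (uniformly bounded bordered inverse) is impossible there: `K₀ ≥ 1`.
With `∂ᵢf = ∂₃f = 0` and `R = 0` this is the rigidity `∂ᵢw ≡ t∂₃w` of `SecondSymmetry`. [folklore]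
-/

set_option linter.dupNamespace false

noncomputable section

namespace Summit.AnomalousDissipation.AnomalousDissipation.Theorems.NonresonantSelection.Negative

open MeasureTheory
open Literature.Analysis.FunctionSpaces
open Literature.Analysis.FluidPDE

/-- Linear combinations of smooth divergence-free fields are divergence free (copy of the private helper of
`SecondSymmetry`). [folklore] -/
private theorem isDivFree_add_smul'' {f g : UnitAddTorus (Fin 3) → EuclideanSpace ℝ (Fin 3)}
    (hf : Torus.IsSmooth f) (hg : Torus.IsSmooth g) (hfd : Torus.IsDivFree f) (hgd : Torus.IsDivFree g)
    (s : ℝ) : Torus.IsDivFree (f + s • g) := by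
  intro x
  have hf0 := hfd x
  have hg0 := hgd x
  simp only [Torus.divergence] at hf0 hg0 ⊢
  have hcoord : ∀ j : Fin 3, (fun y => (f + s • g) y j) = (fun y => f y j) + s • (fun y => g y j) := by
    intro j; funext y; simp [Pi.add_apply, Pi.smul_apply]
  have hterm : ∀ j : Fin 3, Torus.partialDeriv j (fun y => (f + s • g) y j) x
      = Torus.partialDeriv j (fun y => f y j) x + s * Torus.partialDeriv j (fun y => g y j) x := by
    intro j
    rw [hcoord j,
      Torus.partialDeriv_add ((hf.apply j).isContDiff (by simp)) (((hg.apply j).smul s).isContDiff (by simp)),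
      Pi.add_apply, Torus.partialDeriv_const_smul ((hg.apply j).isContDiff (by simp)) s j, Pi.smul_apply,
      smul_eq_mul]
  simp only [hterm, Finset.sum_add_distrib, ← Finset.mul_sum, hf0, hg0, mul_zero, add_zero]

/-- Linear combinations of smooth mean-zero fields have zero mean (copy of the private helper of
`SecondSymmetry`). [folklore] -/
private theorem hasZeroMean_add_smul'' {f g : UnitAddTorus (Fin 3) → EuclideanSpace ℝ (Fin 3)}
    (hf : Torus.IsSmooth f) (hg : Torus.IsSmooth g) (hfm : Torus.HasZeroMean f) (hgm : Torus.HasZeroMean g)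
    (s : ℝ) : Torus.HasZeroMean (f + s • g) := by
  unfold Torus.HasZeroMean at hfm hgm ⊢
  have h1 : (fun x => (f + s • g) x) = fun x => f x + s • g x := by funext x; simp
  have h2 : Integrable (fun x => s • g x) volume := hg.integrable.smul s
  rw [h1, integral_add hf.integrable h2, integral_smul, hfm, hgm, smul_zero, add_zero]

/-- **Border-corrected translation modes bound the bordered constant from below.** Let `w` be smooth
and divergence free, `q` smooth, `ν, c, M` real, and suppose the BORDERED a-priori clause (last clause of
`NeutralTaylorWaves.NonresonantTaylorWaves`, verbatim) holds at `(w, c)` with constant `M`. Then for every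
direction `i` there is `t` (namely `⟨∂ᵢw,∂₃w⟩/‖∂₃w‖₂²`) with
`∫‖∂ᵢw − t∂₃w‖² ≤ M² ∫‖∂ᵢS − t∂₃S‖²`, `S = (w·∇)w − νΔw + ∇q − c∂₃w` the steady map. No steadiness,
no symmetry of the force is assumed. [folklore] -/
theorem bordered_translationMode_le {ν : ℝ} {w : UnitAddTorus (Fin 3) → EuclideanSpace ℝ (Fin 3)}
    {q : UnitAddTorus (Fin 3) → ℝ} {c M : ℝ} (hw : Torus.IsSmooth w) (hq : Torus.IsSmooth q)
    (hdiv : Torus.IsDivFree w) (i : Fin 3)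
    (hB : ∀ (v : UnitAddTorus (Fin 3) → EuclideanSpace ℝ (Fin 3)) (r : UnitAddTorus (Fin 3) → ℝ) (b : ℝ),
      Torus.IsSmooth v → Torus.IsSmooth r → Torus.IsDivFree v → Torus.HasZeroMean v →
      MeasureTheory.integral MeasureTheory.volume (fun x => ‖v x‖ ^ 2) + b ^ 2 ≤
        M ^ 2 * (MeasureTheory.integral MeasureTheory.volume (fun x =>
          ‖Torus.convect w v x + Torus.convect v w x - ν • Torus.laplacian v x +
            Torus.gradient r x - c • Torus.partialDeriv (2 : Fin 3) v x -
            b • Torus.partialDeriv (2 : Fin 3) w x‖ ^ 2) +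
          (MeasureTheory.integral MeasureTheory.volume (fun x =>
            inner ℝ (v x) (Torus.partialDeriv (2 : Fin 3) w x))) ^ 2)) :
    ∃ t : ℝ, MeasureTheory.integral MeasureTheory.volume
        (fun x => ‖Torus.partialDeriv i w x - t • Torus.partialDeriv (2 : Fin 3) w x‖ ^ 2) ≤
      M ^ 2 * MeasureTheory.integral MeasureTheory.volume (fun x =>
        ‖Torus.partialDeriv i (fun y => Torus.convect w w y - ν • Torus.laplacian w y
            + Torus.gradient q y - c • Torus.partialDeriv (2 : Fin 3) w y) x
          - t • Torus.partialDeriv (2 : Fin 3) (fun y => Torus.convect w w y - ν • Torus.laplacian w y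
            + Torus.gradient q y - c • Torus.partialDeriv (2 : Fin 3) w y) x‖ ^ 2) := by
  set w3 := Torus.partialDeriv (2 : Fin 3) w with hw3def
  set wi := Torus.partialDeriv i w with hwidef
  have hw3 : Torus.IsSmooth w3 := hw.partialDeriv 2
  have hwi : Torus.IsSmooth wi := hw.partialDeriv i
  set D := MeasureTheory.integral MeasureTheory.volume (fun x => ‖w3 x‖ ^ 2) with hDdef
  have hD1 : 1 ≤ M ^ 2 * D := bordered_one_le hB
  have hDpos : 0 < D := by
    by_contra hle
    have hle' : D ≤ 0 := le_of_not_gt hle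
    have : M ^ 2 * D ≤ 0 := mul_nonpos_of_nonneg_of_nonpos (sq_nonneg M) hle'
    linarith
  set P := MeasureTheory.integral MeasureTheory.volume (fun x => inner ℝ (wi x) (w3 x)) with hPdef
  set s : ℝ := -(P / D) with hsdef
  have hv : Torus.IsSmooth (wi + s • w3) := hwi.add (hw3.smul s)
  have hr : Torus.IsSmooth (Torus.partialDeriv i q + s • Torus.partialDeriv (2 : Fin 3) q) :=
    (hq.partialDeriv i).add ((hq.partialDeriv 2).smul s)
  have hvd : Torus.IsDivFree (wi + s • w3) :=
    isDivFree_add_smul'' hwi hw3 (isDivFree_partialDeriv hw hdiv i) (isDivFree_partialDeriv hw hdiv 2) s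
  have hvm : Torus.HasZeroMean (wi + s • w3) :=
    hasZeroMean_add_smul'' hwi hw3 (Torus.hasZeroMean_partialDeriv hw i) (Torus.hasZeroMean_partialDeriv hw 2) s
  have key := hB (wi + s • w3) (Torus.partialDeriv i q + s • Torus.partialDeriv (2 : Fin 3) q) 0 hv hr hvd hvm
  set S : UnitAddTorus (Fin 3) → EuclideanSpace ℝ (Fin 3) := fun y => Torus.convect w w y - ν • Torus.laplacian w y
      + Torus.gradient q y - c • Torus.partialDeriv (2 : Fin 3) w y with hSdef
  have hL : ∀ x, Torus.convect w (wi + s • w3) x + Torus.convect (wi + s • w3) w x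
      - ν • Torus.laplacian (wi + s • w3) x
      + Torus.gradient (Torus.partialDeriv i q + s • Torus.partialDeriv (2 : Fin 3) q) x
      - c • Torus.partialDeriv (2 : Fin 3) (wi + s • w3) x
      - (0 : ℝ) • w3 x
      = Torus.partialDeriv i S x + s • Torus.partialDeriv (2 : Fin 3) S x := by
    intro x
    rw [zero_smul, sub_zero,
      linearisation_add_smul (w := w) (ν := ν) (c := c) hwi hw3 (hq.partialDeriv i) (hq.partialDeriv 2) s x,
      hwidef, hw3def, linearisation_partialDeriv_eq hw hq ν c i x, linearisation_partialDeriv_eq hw hq ν c 2 x]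
  have hint_i : Integrable (fun x => inner ℝ (wi x) (w3 x)) volume := (hwi.inner hw3).integrable
  have hint_3 : Integrable (fun x => inner ℝ (w3 x) (w3 x)) volume := (hw3.inner hw3).integrable
  have hD' : MeasureTheory.integral MeasureTheory.volume (fun x => inner ℝ (w3 x) (w3 x)) = D := by
    rw [hDdef]
    refine integral_congr_ae (ae_of_all _ fun x => ?_)
    simp only [real_inner_self_eq_norm_sq]
  have hborder : MeasureTheory.integral MeasureTheory.volume
      (fun x => inner ℝ ((wi + s • w3) x) (w3 x)) = 0 := by
    have h1 : (fun x => inner ℝ ((wi + s • w3) x) (w3 x))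
        = fun x => inner ℝ (wi x) (w3 x) + s * inner ℝ (w3 x) (w3 x) := by
      funext x
      simp only [Pi.add_apply, Pi.smul_apply, inner_add_left, inner_smul_left, RCLike.conj_to_real]
    rw [h1, integral_add hint_i (hint_3.const_mul s), integral_const_mul, hD', ← hPdef, hsdef]
    field_simp
    ring
  refine ⟨P / D, ?_⟩
  have hvx : ∀ x, (wi + s • w3) x = Torus.partialDeriv i w x - (P / D) • Torus.partialDeriv (2 : Fin 3) w x := by
    intro x
    simp only [Pi.add_apply, Pi.neg_apply, Pi.smul_apply, hsdef, neg_smul, ← hwidef, ← hw3def,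
      sub_eq_add_neg]
  have hLx : ∀ x, Torus.partialDeriv i S x + s • Torus.partialDeriv (2 : Fin 3) S x
      = Torus.partialDeriv i S x - (P / D) • Torus.partialDeriv (2 : Fin 3) S x := by
    intro x
    simp only [hsdef, neg_smul, sub_eq_add_neg]
  have key' := key
  simp_rw [hL, hborder, hvx, hLx] at key'
  simpa using key'

end Summit.AnomalousDissipation.AnomalousDissipation.Theorems.NonresonantSelection.Negative

end
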